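import Mathlib.Order.Zorn
import Literature.Geometry.Lorentzian.CauchyProblemMGHDExistence
import Literature.Geometry.Lorentzian.CauchyProblemCauchy
import HarnessLib

/-!
# Choquet-Bruhat–Geroch 1969, Theorem 3: the order-theoretic frame of the printed proof
# (towards `choquetBruhat_geroch_exists_mghd_cauchy`)

`Literature.Geometry.Lorentzian.CauchyProblemMGHDExistence` vendors the existence of the maximal
globally hyperbolic vacuum development (MGHD) as the named fact
`choquetBruhat_geroch_exists_mghd_cauchy` (Choquet-Bruhat–Geroch, Comm. Math. Phys. 14 (1969),
Thm. 3, p. 332; Sbierski, Ann. Henri Poincaré 17 (2016) = arXiv:1309.7591, Thm. 2.8; Ringström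
2009, Thm. 16.6). This sibling file formalizes, sorry-free, the *frame* of the printed proof of
Theorem 3 (pp. 332–333) — the part that is pure order theory — and thereby reduces the fact,
over the prelude, to exactly the two constructions of the printed proof that Mathlib cannot yet
carry. No new named fact is introduced (D-0026): the two constructions enter as *hypotheses* of
theorems, never as `def … : Prop`.

## The printed proof (Choquet-Bruhat–Geroch 1969, pp. 332–334) and its frame

Write `𝒟₁ ≼ 𝒟₂` for "`𝒟₂` is an extension of `𝒟₁`" (`CauchyDevelopment.EmbedsInto`: a smooth,
time-orientation preserving, isometric open embedding commuting with the embeddings of the data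
manifold; p. 331, Definition; Ringström 2009, Def. 16.5; Sbierski 2016, §2, Definition of an
extension). It is a
preorder (`EmbedsInto.refl`, `CauchyDevelopment.lean`; `EmbedsInto.trans`, `CauchyProblemCauchy`).
The printed proof runs:

1. (p. 332, l. 1 of the proof) "By Theorem 1, 𝓜 is not empty" — local existence;
2. (p. 333) "each totally ordered subset of 𝓜 has an upper bound" — the union `K̃` of a chain
   `N_α` of developments along the transition isometries `ψ_αβ` is again a development;
3. (p. 333) "By Zorn's lemma, there is a maximal element M of 𝓜";
4. (pp. 333–334) "It remains to be shown that M is an extension of every development of S": for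
   another development `M'`, glue `M` and `M'` along the maximal common development `(U, ψ)`
   (Theorem 2 = local geometric uniqueness, plus Zorn once more) and prove the glued space
   Hausdorff; it is then a development extending both `M` and `M'`, so equal to `M` by
   maximality, whence `M' ≼ M`.

Steps 1–2 together say precisely: *every chain of developments (the empty chain included) has an
upper bound* (`hchain` below). Step 4, stripped of the appeal to the maximality of `M`, is the
statement that *any two developments of the same data embed into a common third one* — this is
literally Sbierski's "global uniqueness" theorem (arXiv:1309.7591, Thm. 2.7 = Theorem 5 of §2:
"Given two GHDs M and M' of the same initial data, there exists a GHD M̃ that is an extension of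
M and M'"), proved there in §3 by the same gluing-along-the-MCGHD and Hausdorff argument
(`hce` below). Given these two inputs the remaining argument is Zorn's lemma for a preorder
(Mathlib `exists_maximal_of_chains_bounded`) followed by three lines: if `m` is Zorn-maximal and
`𝒟'` is arbitrary, pick a common extension `𝒟₃` of `m` and `𝒟'`; then `m ≼ 𝒟₃` forces `𝒟₃ ≼ m`,
and `𝒟' ≼ 𝒟₃ ≼ m`.

## What is proved here

* `CauchyDevelopment.exists_isMaximalAmong_of_chains_bounded_of_common_extension` — the frame for
  an arbitrary class `P` of Cauchy developments (Choquet-Bruhat–Geroch, p. 331: "our theorem is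
  applicable to any system of equations whose solutions define a spacetime and which satisfy 1
  and 2, e.g., to Einstein's equations with sources"), and its vacuum specialisation
  `VacuumCauchyDevelopment.exists_isMaximal_of_chains_bounded_of_common_extension`;
* the converses `VacuumCauchyDevelopment.IsMaximal.chains_bounded`,
  `VacuumCauchyDevelopment.IsMaximal.common_extension` (an MGHD bounds every chain and is a common
  extension of any two developments), assembled in
  `VacuumCauchyDevelopment.exists_isMaximal_iff_chains_bounded_and_common_extension`: over the
  prelude, MGHD existence for a data set is *equivalent* to the conjunction of the two inputs;
* `choquetBruhat_geroch_exists_mghd_cauchy_of_chains_bounded_of_common_extension` — the named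
  fact follows from the two inputs stated in its own `Σ`-context.

## What remains for `choquetBruhat_geroch_exists_mghd_cauchy_holds` (recorded, not vendored)

(a) `hchain`: local existence (Choquet-Bruhat 1952; Ringström 2009, Thm. 14.2: reduced Einstein
equations in wave gauge as a quasilinear hyperbolic system, `H^s` local theory, constraint and
gauge propagation, patching) for the empty chain, and the union-of-a-chain development (colimit of
smooth Lorentzian manifolds along open isometric embeddings: charts, metric, time orientation
and Cauchy property descend; second countability of the union from the Lorentzian metric plus
time orientation, Geroch 1968) for nonempty chains; (b) `hce`: Sbierski 2016, §3 (its first lemma =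
rigidity of isometric immersions via the exponential map; existence of the maximal common
globally hyperbolic development; absence of corresponding boundary points, using local
uniqueness and the causality theory of O'Neill 1983, Ch. 14 / Ringström 2009, Ch. 23; the
quotient-manifold gluing). None of these has a carrier in Mathlib at the pin (no exponential map
or geodesic uniqueness for the Koszul connection, no wave equations, no gluing of manifolds).

## References

* Y. Choquet-Bruhat, R. Geroch, *Global aspects of the Cauchy problem in general relativity*,
  Comm. Math. Phys. 14 (1969), 329–335: Thm. 1 and Definition (p. 331), Thm. 2 (p. 331), Thm. 3
  and its proof (pp. 332–334).
* J. Sbierski, *On the existence of a maximal Cauchy development for the Einstein equations: a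
  dezornification*, Ann. Henri Poincaré 17 (2016), 301–329 = arXiv:1309.7591v3: §2 (Definitions
  of GHD, extension, CGHD), Thm. 2.6 (local theory), Thm. 2.7 (global uniqueness = common
  extension), Thm. 2.8 (MGHD), §3 (proofs).
* H. Ringström, *The Cauchy Problem in General Relativity*, EMS 2009, Def. 16.5, Thm. 16.6, Ch. 23.
-/

noncomputable section

open scoped Manifold ContDiff

namespace Literature.Geometry.Lorentzian

universe u

section Frame

variable {n : ℕ} {X : Type u} [TopologicalSpace X] [ChartedSpace (EuclideanSpace ℝ (Fin n)) X]
  [IsManifold (𝓡 n) ∞ X] [ConnectedSpace X] {D : InitialDataSet (𝓡 n) X}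

namespace CauchyDevelopment

/-- **The order-theoretic frame of Choquet-Bruhat–Geroch's proof of Theorem 3, for an arbitrary
class `P` of Cauchy developments** (vacuum, or "Einstein's equations with sources such as perfect
fluids, electromagnetic fields, etc.", p. 331). Suppose (i) every chain (for the preorder
`EmbedsInto`, "is extended by") of Cauchy developments of `D` satisfying `P` — the empty chain
included — has an upper bound satisfying `P` (Theorem 1, local existence, and the union
development of a chain, p. 333), and (ii) any two Cauchy developments satisfying `P` embed into a
common one satisfying `P` (Theorem 2 with the gluing and Hausdorff argument of pp. 333–334;
Sbierski 2016, Thm. 2.7). Then some Cauchy development is maximal among those satisfying `P`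
(`IsMaximalAmong`): by Zorn's lemma (Mathlib `exists_maximal_of_chains_bounded`, transitivity
`EmbedsInto.trans`) there is `m` with `P m` such that `m ≼ 𝒟 → 𝒟 ≼ m` whenever `P 𝒟`; given
`𝒟'` with `P 𝒟'`, a common extension `𝒟₃` of `m` and `𝒟'` has `𝒟₃ ≼ m`, hence
`𝒟' ≼ 𝒟₃ ≼ m`. [cite: ChoquetBruhatGeroch1969CMP, Thm. 3, proof (pp. 332–334)] -/
theorem exists_isMaximalAmong_of_chains_bounded_of_common_extension
    (P : CauchyDevelopment D → Prop)
    (hchain : ∀ c : Set (CauchyDevelopment D), (∀ 𝒟 ∈ c, P 𝒟) → IsChain EmbedsInto c →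
      ∃ ub : CauchyDevelopment D, P ub ∧ ∀ 𝒟 ∈ c, 𝒟.EmbedsInto ub)
    (hce : ∀ 𝒟₁ 𝒟₂ : CauchyDevelopment D, P 𝒟₁ → P 𝒟₂ →
      ∃ 𝒟₃ : CauchyDevelopment D, P 𝒟₃ ∧ 𝒟₁.EmbedsInto 𝒟₃ ∧ 𝒟₂.EmbedsInto 𝒟₃) :
    ∃ 𝒟 : CauchyDevelopment D, 𝒟.IsMaximalAmong P := by
  -- chains of `P`-developments are bounded, by `hchain` applied to the underlying chain
  have hbdd : ∀ c : Set {𝒟 : CauchyDevelopment D // P 𝒟},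
      IsChain (fun 𝒟₁ 𝒟₂ ↦ 𝒟₁.1.EmbedsInto 𝒟₂.1) c →
        ∃ ub : {𝒟 : CauchyDevelopment D // P 𝒟}, ∀ 𝒟 ∈ c, 𝒟.1.EmbedsInto ub.1 := by
    intro c hc
    obtain ⟨ub, hub, h⟩ := hchain (Subtype.val '' c) (by rintro _ ⟨𝒟, -, rfl⟩; exact 𝒟.2)
      (hc.image_of_map_rel _ _ Subtype.val fun _ _ h ↦ h)
    exact ⟨⟨ub, hub⟩, fun 𝒟 h𝒟 ↦ h 𝒟.1 (Set.mem_image_of_mem _ h𝒟)⟩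
  -- Zorn's lemma on the developments satisfying `P`, preordered by `EmbedsInto`
  obtain ⟨m, hm⟩ := exists_maximal_of_chains_bounded hbdd (fun h₁₂ h₂₃ ↦ h₁₂.trans h₂₃)
  -- a Zorn-maximal `m` is an extension of every development, by the common extension property
  refine ⟨m.1, m.2, fun 𝒟' h' ↦ ?_⟩
  obtain ⟨𝒟₃, h₃, hm₃, h'₃⟩ := hce m.1 𝒟' m.2 h'
  exact h'₃.trans (hm ⟨𝒟₃, h₃⟩ hm₃)

/-- Conversely, a Cauchy development maximal among those satisfying `P` bounds every family of
`P`-developments (in particular every chain). Choquet-Bruhat–Geroch 1969, p. 334 ("a development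
M of S is maximal if M is an extension of every other development of S").
[cite: ChoquetBruhatGeroch1969CMP, Thm. 3 (p. 334)] -/
theorem IsMaximalAmong.bounds {P : CauchyDevelopment D → Prop} {𝒟 : CauchyDevelopment D}
    (h : 𝒟.IsMaximalAmong P) (c : Set (CauchyDevelopment D)) (hc : ∀ 𝒟' ∈ c, P 𝒟') :
    ∃ ub : CauchyDevelopment D, P ub ∧ ∀ 𝒟' ∈ c, 𝒟'.EmbedsInto ub :=
  ⟨𝒟, h.1, fun 𝒟' h' ↦ h.2 𝒟' (hc 𝒟' h')⟩

/-- Conversely, a Cauchy development maximal among those satisfying `P` is a common extension of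
any two `P`-developments (the trivial direction of "Theorem 2.8 clearly implies Theorem 2.7",
Sbierski 2016, after Thm. 2.8). [cite: ChoquetBruhatGeroch1969CMP, Thm. 3 (p. 334)] -/
theorem IsMaximalAmong.common_extension {P : CauchyDevelopment D → Prop} {𝒟 : CauchyDevelopment D}
    (h : 𝒟.IsMaximalAmong P) (𝒟₁ 𝒟₂ : CauchyDevelopment D) (h₁ : P 𝒟₁) (h₂ : P 𝒟₂) :
    ∃ 𝒟₃ : CauchyDevelopment D, P 𝒟₃ ∧ 𝒟₁.EmbedsInto 𝒟₃ ∧ 𝒟₂.EmbedsInto 𝒟₃ :=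
  ⟨𝒟, h.1, h.2 𝒟₁ h₁, h.2 𝒟₂ h₂⟩

end CauchyDevelopment

namespace VacuumCauchyDevelopment

/-- **The frame of Choquet-Bruhat–Geroch's proof of Theorem 3, vacuum case.** If (i) every chain
of vacuum Cauchy developments of `D` (for `EmbedsInto`; the empty chain included) has an upper
bound — Choquet-Bruhat–Geroch 1969, Thm. 1 (p. 331, local existence) and the union development of
a chain (p. 333) — and (ii) any two vacuum Cauchy developments of `D` embed into a common one —
Thm. 2 (p. 331, local uniqueness) with the gluing and Hausdorff argument of pp. 333–334, i.e.
Sbierski 2016, Thm. 2.7 — then `D` has a maximal vacuum Cauchy development (`IsMaximal`): Zorn's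
lemma gives a development `m` extended only by developments it extends, and for any `𝒟'` a
common extension `𝒟₃` of `m` and `𝒟'` yields `𝒟' ≼ 𝒟₃ ≼ m`
(`CauchyDevelopment.exists_isMaximalAmong_of_chains_bounded_of_common_extension` with
`P` = Ricci-flat, `isMaximal_iff_isMaximalAmong`).
[cite: ChoquetBruhatGeroch1969CMP, Thm. 3, proof (pp. 332–334)] -/
theorem exists_isMaximal_of_chains_bounded_of_common_extension
    (hchain : ∀ c : Set (VacuumCauchyDevelopment.{u} D),
      IsChain (fun 𝒟₁ 𝒟₂ ↦ 𝒟₁.toCauchyDevelopment.EmbedsInto 𝒟₂.toCauchyDevelopment) c →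
        ∃ ub : VacuumCauchyDevelopment.{u} D,
          ∀ 𝒟 ∈ c, 𝒟.toCauchyDevelopment.EmbedsInto ub.toCauchyDevelopment)
    (hce : ∀ 𝒟₁ 𝒟₂ : VacuumCauchyDevelopment.{u} D, ∃ 𝒟₃ : VacuumCauchyDevelopment.{u} D,
      𝒟₁.toCauchyDevelopment.EmbedsInto 𝒟₃.toCauchyDevelopment ∧
        𝒟₂.toCauchyDevelopment.EmbedsInto 𝒟₃.toCauchyDevelopment) :
    ∃ 𝒟 : VacuumCauchyDevelopment.{u} D, 𝒟.IsMaximal := by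
  -- Zorn's lemma on the vacuum Cauchy developments, preordered by `EmbedsInto`
  obtain ⟨m, hm⟩ := exists_maximal_of_chains_bounded hchain
    (fun h₁₂ h₂₃ ↦ CauchyDevelopment.EmbedsInto.trans h₁₂ h₂₃)
  -- a Zorn-maximal `m` is an extension of every development, by the common extension property
  refine ⟨m, fun 𝒟' ↦ ?_⟩
  obtain ⟨𝒟₃, hm₃, h'₃⟩ := hce m 𝒟'
  exact h'₃.trans (hm 𝒟₃ hm₃)

/-- Conversely, a maximal vacuum Cauchy development bounds every family (in particular every
chain) of vacuum Cauchy developments of the same data. Choquet-Bruhat–Geroch 1969, p. 334.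
[cite: ChoquetBruhatGeroch1969CMP, Thm. 3 (p. 334)] -/
theorem IsMaximal.chains_bounded {𝒟 : VacuumCauchyDevelopment.{u} D} (h : 𝒟.IsMaximal)
    (c : Set (VacuumCauchyDevelopment.{u} D)) :
    ∃ ub : VacuumCauchyDevelopment.{u} D,
      ∀ 𝒟' ∈ c, 𝒟'.toCauchyDevelopment.EmbedsInto ub.toCauchyDevelopment :=
  ⟨𝒟, fun 𝒟' _ ↦ h 𝒟'⟩

/-- Conversely, a maximal vacuum Cauchy development is a common extension of any two vacuum
Cauchy developments of the same data ("Theorem 2.8 clearly implies Theorem 2.7", Sbierski 2016).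
[cite: ChoquetBruhatGeroch1969CMP, Thm. 3 (p. 334)] -/
theorem IsMaximal.common_extension {𝒟 : VacuumCauchyDevelopment.{u} D} (h : 𝒟.IsMaximal)
    (𝒟₁ 𝒟₂ : VacuumCauchyDevelopment.{u} D) :
    ∃ 𝒟₃ : VacuumCauchyDevelopment.{u} D,
      𝒟₁.toCauchyDevelopment.EmbedsInto 𝒟₃.toCauchyDevelopment ∧
        𝒟₂.toCauchyDevelopment.EmbedsInto 𝒟₃.toCauchyDevelopment :=
  ⟨𝒟, h 𝒟₁, h 𝒟₂⟩

/-- **Over the prelude, MGHD existence for a data set is equivalent to the conjunction of the two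
inputs of the printed proof**: every chain of vacuum Cauchy developments is bounded (Thm. 1 and
the union development) and any two vacuum Cauchy developments have a common extension (Thm. 2
with gluing; Sbierski 2016, Thm. 2.7). Forward: an MGHD bounds everything; backward:
`exists_isMaximal_of_chains_bounded_of_common_extension` (Zorn).
[cite: ChoquetBruhatGeroch1969CMP, Thm. 3, proof (pp. 332–334)] -/
theorem exists_isMaximal_iff_chains_bounded_and_common_extension :
    (∃ 𝒟 : VacuumCauchyDevelopment.{u} D, 𝒟.IsMaximal) ↔
      (∀ c : Set (VacuumCauchyDevelopment.{u} D),
        IsChain (fun 𝒟₁ 𝒟₂ ↦ 𝒟₁.toCauchyDevelopment.EmbedsInto 𝒟₂.toCauchyDevelopment) c →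
          ∃ ub : VacuumCauchyDevelopment.{u} D,
            ∀ 𝒟 ∈ c, 𝒟.toCauchyDevelopment.EmbedsInto ub.toCauchyDevelopment) ∧
      (∀ 𝒟₁ 𝒟₂ : VacuumCauchyDevelopment.{u} D, ∃ 𝒟₃ : VacuumCauchyDevelopment.{u} D,
        𝒟₁.toCauchyDevelopment.EmbedsInto 𝒟₃.toCauchyDevelopment ∧
          𝒟₂.toCauchyDevelopment.EmbedsInto 𝒟₃.toCauchyDevelopment) :=
  ⟨fun ⟨_, h⟩ ↦ ⟨fun c _ ↦ h.chains_bounded c, h.common_extension⟩,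
    fun ⟨hchain, hce⟩ ↦ exists_isMaximal_of_chains_bounded_of_common_extension hchain hce⟩

end VacuumCauchyDevelopment

end Frame

/-! ### The named fact from the two inputs of the printed proof -/

/-- **`choquetBruhat_geroch_exists_mghd_cauchy` from the two constructions of the printed proof.**
If, for every connected Hausdorff second countable smooth `3`-manifold `X` and every smooth
solution `D` of the vacuum constraints on `X`, (i) every chain of vacuum Cauchy developments of
`D` has an upper bound (Choquet-Bruhat–Geroch 1969, Thm. 1, p. 331 — Fourès-Bruhat 1952;
Ringström 2009, Thm. 14.2 — for the empty chain, and the union development of p. 333 otherwise)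
and (ii) any two vacuum Cauchy developments of `D` embed into a common one (Thm. 2, p. 331, with
the gluing and Hausdorff argument of pp. 333–334; Sbierski 2016, Thm. 2.7), then the named fact
holds: this is the printed proof of Theorem 3 with its two analytic–geometric inputs displayed as
hypotheses (`VacuumCauchyDevelopment.exists_isMaximal_of_chains_bounded_of_common_extension`).
[cite: ChoquetBruhatGeroch1969CMP, Thm. 3, proof (pp. 332–334)] -/
theorem choquetBruhat_geroch_exists_mghd_cauchy_of_chains_bounded_of_common_extension
    (hchain : ∀ (X : Type) [TopologicalSpace X] [ChartedSpace (EuclideanSpace ℝ (Fin 3)) X]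
      [IsManifold (𝓡 3) ∞ X] [T2Space X] [SecondCountableTopology X] [ConnectedSpace X]
      (D : InitialDataSet (𝓡 3) X) [D.metric.HasLeviCivita], D.IsVacuumConstraintSolution →
      ∀ c : Set (VacuumCauchyDevelopment D),
        IsChain (fun 𝒟₁ 𝒟₂ ↦ 𝒟₁.toCauchyDevelopment.EmbedsInto 𝒟₂.toCauchyDevelopment) c →
          ∃ ub : VacuumCauchyDevelopment D,
            ∀ 𝒟 ∈ c, 𝒟.toCauchyDevelopment.EmbedsInto ub.toCauchyDevelopment)
    (hce : ∀ (X : Type) [TopologicalSpace X] [ChartedSpace (EuclideanSpace ℝ (Fin 3)) X]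
      [IsManifold (𝓡 3) ∞ X] [T2Space X] [SecondCountableTopology X] [ConnectedSpace X]
      (D : InitialDataSet (𝓡 3) X) [D.metric.HasLeviCivita], D.IsVacuumConstraintSolution →
      ∀ 𝒟₁ 𝒟₂ : VacuumCauchyDevelopment D, ∃ 𝒟₃ : VacuumCauchyDevelopment D,
        𝒟₁.toCauchyDevelopment.EmbedsInto 𝒟₃.toCauchyDevelopment ∧
          𝒟₂.toCauchyDevelopment.EmbedsInto 𝒟₃.toCauchyDevelopment) :
    choquetBruhat_geroch_exists_mghd_cauchy :=
  fun X _ _ _ _ _ _ D _ hD ↦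
    VacuumCauchyDevelopment.exists_isMaximal_of_chains_bounded_of_common_extension
      (hchain X D hD) (hce X D hD)

end Literature.Geometry.Lorentzian

end
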